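import Literature.MathematicalPhysics.QuantumFieldTheory.Balaban1983to89.Node00.BackgroundCurrentCompare
import Literature.MathematicalPhysics.QuantumFieldTheory.Balaban1983to89.Node00.CriticalOnFibreTangent
import Literature.MathematicalPhysics.QuantumFieldTheory.Balaban1983to89.B9Eq310HessianOperator
import Literature.MathematicalPhysics.QuantumFieldTheory.Balaban1983to89.B9TorusCalculus
import Literature.MathematicalPhysics.QuantumFieldTheory.Balaban1983to89.B12ActionExpansion26Lattice
import Mathlib.Analysis.InnerProductSpace.PiL2

/-!
# NODE 00 — [Balaban1985Variational] Sect. B (26) ∕ [Balaban1985BackgroundPropagators] (3.10): THE HESSIAN OPERATOR `Δ^η(U₀)` OF THE ACTION OF RECORD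
# AT AN `SU(N)` BACKGROUND OF RECORD, as a symmetric `ℝ`-linear operator on the Euclidean space of `𝔰𝔲(N)`-valued bond fields of `T^{(j)}`
# (the tangent directions of dag-n07-e's chart `expChart U₀ X = U₀·exp X`), REPRESENTING pv27's printed quadratic form `⟨A, Δ^η(U₀)A⟩`
# (`B9Eq39Adjoint.hessPair`, the second-order coefficient of (26)) at print's hermitian letter `A_X := (iη)⁻¹·U₀XU₀*`

Cell `pub-ymgap` (HUMAN RULING D-0062 ∕ D-0149), Track A node N07 = [Balaban1985Variational]; width seat `pub-ymgap-dag-n07-w1` (g0), item S1 of dag-n07-e's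
`W-SEAT-START-LIST-N07.md` («[15] Sect. B at objects»), located gap **D2** of the audit `HOME/pub-ymgap-dag-n07-w1/S1-SECTB-AUDIT.md` («`Δ^η(U₀)` as a NAMED
ℝ-linear operator on 𝔰𝔲(N)-valued bond fields of `F.P K`»).  NEW leaf module; CONSUMED BY NAME, nothing modified: pv27 `B9Eq39Adjoint` (`bondPair` (3.11), `hessPair`
(3.10)) and `B9Eq310Hermitian` (`deltaOp`, `bondPair_deltaOp_symm ∕ _self`, `deltaOp_add_fun ∕ _smul`), the torus datum `B9TorusCalculus.torusT`, dag-n01-b's `Node00.cfgGL` ∕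
`B12Eq18Current.dirForm`, the lineage's Riesz brick `B9Eq310HessianOperator.opOfSesq ∕ inner_opOfSesq` (pub-balaban NE9), `T4AdjointCovarianceUnitary.lieSU` with its
pinned Hilbert–Schmidt inner product.  `--kind definition --supports stmt-QuantumFields-20542` (K1⁷; count-neutral).

WHY.  k0-s1-w1's coordinate-free (127) ⟹ (143) ⟹ (158) file (`…K0Stub1CriticalEquation143CoordFree`, INBOX l.24297) is stated over «an arbitrary finite-dimensional
real inner-product space `E` of fields with `Δ` positive on the tangent space»; n07-w2's chart (S2) and n07-w4's assembly (S6) need THE `E` and THE `Δ(U₀)` of the record.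
The print ([5] p. 391–392) takes «natural L² scalar products for functions with values in N × N hermitian matrices … X·Y = tr XY» and calls `Δ^η(U)` «a hermitian
operator given by the quadratic form (3.10)»; pv27 typed the form (`hessPair`) and the pointwise operator (`deltaOp`) on `𝔸`-valued fields.  For `SU(N)` the tangent
directions are `𝔰𝔲(N)`-valued (skew, traceless: NODE 00's `lieSU`), print's hermitian letter being `A_X = (iη)⁻¹·U₀XU₀*` (dag-n07-w1's `prodCfg_eq_dirForm_expChart`:
`e^{iηA_X}·U₀ = U₀·exp X`); the operator the variational problem sees is the one REPRESENTING the form on that space — the Riesz representative (a compression: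
`deltaOp`'s `Δ′` part does not preserve tracelessness, the inner product only reads the traceless part).  This module builds exactly that, with no estimate.

CONTENTS (definitions with bodies + kernel bookkeeping; `τ_N := N⁻¹·tr` written as the term `(N : ℂ)⁻¹ • Matrix.traceLinearMap (Fin N) ℂ ℂ`).
* §1 `TangentBondSU P j N := PiLp 2 (fun _ : PBond P j => lieSU (Fin N))` (the carrier `E`); `hermLetter η U₀ X` (print's `A_X` in pv27's `ι → S → 𝔸` shape),
  `hermLetter_add ∕ _smul` (ℝ-linear in `X`).
* §2 `hessFormAt η U₀ X Y := Re (bondPair η 4 τ_N (A_X) (deltaOp (torusT P j) (dirForm (cfgGL N U₀)) η (A_Y)))`; `hessFormAt_symm` (pv27 `bondPair_deltaOp_symm`),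
  `hessFormAt_add_left∕right`, `hessFormAt_smul_left∕right` (r08's `B12ActionExpansion26Lattice.bondPair_smul_right` BY NAME; `τ_N` tracial inline — Summits-side twin `…N07SectBExpansionAtObjects.trN_mul_comm`), ★ `hessFormAt_self` (diagonal = `Re hessPair … (A_X)` = print's `⟨A,ΔA⟩`);
  `hessSesqAt` (the `→ₗ⋆[ℝ] … →ₗ[ℝ] ℝ` packaging, `hessSesqAt_apply`).
* §3 ★ `hessOpAt η U₀ := opOfSesq (hessSesqAt η U₀) : TangentBondSU P j N →ₗ[ℝ] TangentBondSU P j N`; ★ `inner_hessOpAt` (`⟪X, Δ_{U₀}Y⟫ = 𝔥_{U₀}(X,Y)`),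
  ★ `hessOpAt_isSymmetric`, ★ `inner_hessOpAt_self` (`⟪X, Δ_{U₀}X⟫ = Re ⟨A_X, Δ^η(U₀)A_X⟩`).
* §4 the dictionary to the carrier's inner product: `inner_tangentBondSU` (`⟪X,Y⟫ = Σ_b Re tr(X_b*Y_b)`), ★ `re_bondPair_hermLetter` (`Re ⟨A_X, A_Y⟩_{(3.11)} = (η²∕N)·⟪X, Y⟫`,
  `η ≠ 0`) — so print's pairings of hermitian letters and the Euclidean structure of `E` differ by the displayed factor only.
* §5 the flat background: `dirForm_cfgGL_one`, `hermLetter_one`, `deltaPrime_one` (pv27's `Δ′` form vanishes at `U = 1`), ★ `hessFormAt_one_self`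
  (`𝔥_1(X,X) = N⁻¹ Σ_p Re tr((dX)(p)*(dX)(p))`, `dX` = pv27's flat `curl` of `X`; `η` drops out), ★ `hessFormAt_one_self_nonneg`, `inner_hessOpAt_one_self_nonneg` (`Δ_1 ≥ 0`).
NORM SCOPES.  §2–§3 elaborate under `open scoped Matrix.Norms.L2Operator` (pv27's `hessPair` is stated over a normed algebra); §5 again under the `L2Operator` scope; §4 needs no matrix norm (the carrier's
inner product is `lieSU`'s pinned Hilbert–Schmidt one, unfolded by `rfl`); no instance is declared, no local∕scoped instance attribute is used.
READINGS displayed.  (R1) CONVENTION: the carrier is SKEW (`lieSU`, NODE 00's vocabulary for tangent directions, 35a–35e); print's HERMITIAN letters enter only through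
`hermLetter` (announced default, INBOX «D2 QUESTION», dag-n07-w1 g0).  (R2) The form is pv27's (3.10) form at `d = 4` with the scale parameter `η` free (consumers take
`η := (F.P K).eta k`); its value is REAL at an `SU(N)` background (`hessPair_im_cfgGL`, Summits-side), so taking `Re` loses nothing.  (R3) `⟪·,·⟫` on `lieSU` is
`Re tr(X*Y)` (UNNORMALISED Hilbert–Schmidt, `T4AdjointCovarianceUnitary`), while `τ_N` is normalised: the representing operator absorbs the factor; no claim that `hessOpAt` equals
a pointwise formula.  (R4) The junction «`⟪X, Δ_{U₀}X⟫` = the second-order term of `wilsonAction4 (expChart U₀ X)`» is Summits-side (dag-n07-w1 `…N07SectBExpansionAtObjects`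
§5 `wilsonAction4_expChart_expansion` + `inner_hessOpAt_self`), not restated here.

HONEST FRAMING.  Definitions + finite-dimensional linear algebra BY NAME; NO estimate (no positivity, no bound — those are [15] Sect. F ∕ S4's); nothing of Bałaban asserted;
N07 NOT discharged; K1⁷ NOT closed; counts unmoved (28∕28 · 5∕27); one finite 𝕋⁴ programme at fixed ε — NOT continuum ∕ ℝ⁴ ∕ OS ∕ mass gap ∕ Clay.  No `sorry`,
no `instance`, no `notation`, standard axioms.
-/

noncomputable section

namespace Literature.MathematicalPhysics.QuantumFieldTheory.Balaban1983to89.Node00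

open scoped InnerProductSpace
open B9Eq39Adjoint (bondPair hessPair)
open B9Eq310Hermitian (deltaOp)
open B9TorusCalculus (torusT)
open B12Eq18Current (dirForm)
open T4AdjointCovarianceUnitary (lieSU)

variable {N : ℕ} {P : Params} {j : ℕ}

/-! ## §1 The carrier: the Euclidean space of `𝔰𝔲(N)`-valued bond fields on `T^{(j)}` -/

/-- **THE TANGENT CARRIER**: `𝔰𝔲(N)`-valued bond fields on the positively oriented bonds of `T^{(j)}` with the `ℓ²` (Hilbert–Schmidt) inner product
`⟪X, Y⟫ = Σ_b Re tr(X_b* Y_b)` — the real Hilbert space on which [5] p. 391's «natural L² scalar products for functions with values in N × N hermitian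
matrices» is read for `SU(N)` (hermitian `A = −iX`; `tr(A₁A₂) = Re tr(X₁*X₂)`). [cite: Balaban1985BackgroundPropagators, p.391 («natural L² scalar products»); Balaban1985Averaging, (17) p.21] -/
abbrev TangentBondSU (P : Params) (j : ℕ) (N : ℕ) : Type := PiLp 2 (fun _ : PBond P j => lieSU (Fin N))

/-- **PRINT'S HERMITIAN LETTER OF A TANGENT DIRECTION** at the background `U₀`: `A_X(x, μ) := (iη)⁻¹ · U₀(b) X(b) U₀(b)*`, `b = ⟨x, μ⟩` — the bond field `A`
of [15] (22) `U₁ = e^{iηA}` for which `e^{iηA_X}·U₀ = U₀·exp X` (dag-n07-w1 `prodCfg_eq_dirForm_expChart`), in pv27's `ι → S → 𝔸` shape.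
[cite: Balaban1985Variational, (22) p.281; Balaban1985BackgroundPropagators, (3.1) p.390 («U′ = exp iηA»)] -/
def hermLetter (η : ℝ) (U₀ : GaugeField P j (SU N)) (X : TangentBondSU P j N) : Fin P.d → Site P j → Matrix (Fin N) (Fin N) ℂ :=
  fun μ x => ((Complex.I * η : ℂ))⁻¹ •
    (((U₀ ⟨x, μ⟩ : SU N) : Matrix (Fin N) (Fin N) ℂ) * ((X ⟨x, μ⟩ : lieSU (Fin N)) : Matrix (Fin N) (Fin N) ℂ) *
      star ((U₀ ⟨x, μ⟩ : SU N) : Matrix (Fin N) (Fin N) ℂ))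

/-- `A_{X+Y} = A_X + A_Y`. [cite: Balaban1985Variational, (22) p.281 (bookkeeping)] -/
theorem hermLetter_add (η : ℝ) (U₀ : GaugeField P j (SU N)) (X Y : TangentBondSU P j N) :
    hermLetter η U₀ (X + Y) = hermLetter η U₀ X + hermLetter η U₀ Y := by
  funext μ x
  simp only [hermLetter, PiLp.add_apply, Submodule.coe_add, Pi.add_apply, mul_add, add_mul, smul_add]

/-- `A_{c•X} = c • A_X` (`c` real). [cite: Balaban1985Variational, (22) p.281 (bookkeeping)] -/
theorem hermLetter_smul (η : ℝ) (U₀ : GaugeField P j (SU N)) (c : ℝ) (X : TangentBondSU P j N) :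
    hermLetter η U₀ (c • X) = (c : ℂ) • hermLetter η U₀ X := by
  funext μ x
  simp only [hermLetter, PiLp.smul_apply, Submodule.coe_smul, Pi.smul_apply, RCLike.real_smul_eq_coe_smul (K := ℂ),
    Matrix.mul_smul, Matrix.smul_mul]
  exact smul_comm _ _ _

/-! ## §2 The Hessian bilinear form of the action of record at `U₀` on the tangent carrier -/

section Form
open scoped Matrix.Norms.L2Operator

/-- **THE HESSIAN FORM** `𝔥_{U₀}(X, Y) := Re ⟨A_X, Δ^η(U₀) A_Y⟩` — pv27's pairing (3.11) `bondPair` of print's letter `A_X` with the operator (3.10)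
`B9Eq310Hermitian.deltaOp` applied to `A_Y`, at the torus datum of record `(torusT P j, dirForm (cfgGL N U₀))`, trace `τ_N = N⁻¹·tr`, `d = 4`.
[cite: Balaban1985BackgroundPropagators, (3.10)–(3.11) p.392; Balaban1985Variational, (26) p.282] -/
def hessFormAt (η : ℝ) (U₀ : GaugeField P j (SU N)) (X Y : TangentBondSU P j N) : ℝ :=
  (bondPair η 4 ((N : ℂ)⁻¹ • Matrix.traceLinearMap (Fin N) ℂ ℂ) (hermLetter η U₀ X)
    (deltaOp (torusT P j) (dirForm (cfgGL N U₀)) η (hermLetter η U₀ Y))).re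

/-- **`𝔥_{U₀}` IS SYMMETRIC** — pv27's `bondPair_deltaOp_symm` («it is a hermitian operator», [5] (3.10)). [cite: Balaban1985BackgroundPropagators, (3.10) p.392] -/
theorem hessFormAt_symm (η : ℝ) (U₀ : GaugeField P j (SU N)) (X Y : TangentBondSU P j N) : hessFormAt η U₀ X Y = hessFormAt η U₀ Y X := by
  unfold hessFormAt
  rw [B9Eq310Hermitian.bondPair_deltaOp_symm (torusT P j) (dirForm (cfgGL N U₀)) _ (fun a b => by simp [Matrix.trace_mul_comm a b])]

/-- `𝔥_{U₀}` is additive in the second slot. [cite: Balaban1985BackgroundPropagators, (3.10) p.392 (bookkeeping)] -/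
theorem hessFormAt_add_right (η : ℝ) (U₀ : GaugeField P j (SU N)) (X Y Z : TangentBondSU P j N) :
    hessFormAt η U₀ X (Y + Z) = hessFormAt η U₀ X Y + hessFormAt η U₀ X Z := by
  unfold hessFormAt
  rw [hermLetter_add, B9Eq310Hermitian.deltaOp_add_fun, B9Eq310Hermitian.bondPair_add_right, Complex.add_re]

/-- `𝔥_{U₀}` is homogeneous in the second slot. [cite: Balaban1985BackgroundPropagators, (3.10) p.392 (bookkeeping)] -/
theorem hessFormAt_smul_right (η : ℝ) (U₀ : GaugeField P j (SU N)) (c : ℝ) (X Y : TangentBondSU P j N) :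
    hessFormAt η U₀ X (c • Y) = c * hessFormAt η U₀ X Y := by
  unfold hessFormAt
  have hΔ : deltaOp (torusT P j) (dirForm (cfgGL N U₀)) η ((c : ℂ) • hermLetter η U₀ Y) =
      (c : ℂ) • deltaOp (torusT P j) (dirForm (cfgGL N U₀)) η (hermLetter η U₀ Y) := by
    funext μ x
    exact B9Eq310Hermitian.deltaOp_smul (torusT P j) (dirForm (cfgGL N U₀)) η (c : ℂ) (hermLetter η U₀ Y) μ x
  rw [hermLetter_smul, hΔ, B12ActionExpansion26Lattice.bondPair_smul_right, Complex.re_ofReal_mul]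

/-- `𝔥_{U₀}` is additive in the first slot (by symmetry). [cite: Balaban1985BackgroundPropagators, (3.10) p.392 (bookkeeping)] -/
theorem hessFormAt_add_left (η : ℝ) (U₀ : GaugeField P j (SU N)) (X Y Z : TangentBondSU P j N) :
    hessFormAt η U₀ (X + Y) Z = hessFormAt η U₀ X Z + hessFormAt η U₀ Y Z := by
  rw [hessFormAt_symm, hessFormAt_add_right, hessFormAt_symm η U₀ Z X, hessFormAt_symm η U₀ Z Y]

/-- `𝔥_{U₀}` is homogeneous in the first slot (by symmetry). [cite: Balaban1985BackgroundPropagators, (3.10) p.392 (bookkeeping)] -/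
theorem hessFormAt_smul_left (η : ℝ) (U₀ : GaugeField P j (SU N)) (c : ℝ) (X Y : TangentBondSU P j N) :
    hessFormAt η U₀ (c • X) Y = c * hessFormAt η U₀ X Y := by
  rw [hessFormAt_symm, hessFormAt_smul_right, hessFormAt_symm η U₀ Y X]

/-- **ON THE DIAGONAL `𝔥_{U₀}(X, X)` IS PRINT'S QUADRATIC FORM `⟨A_X, Δ^η(U₀)A_X⟩` of (26) ∕ (3.10)** (pv27's `hessPair`; real part — the form is real at an
`SU(N)` background, dag-n07-w1 `hessPair_im_cfgGL`). [cite: Balaban1985BackgroundPropagators, (3.10) p.392; Balaban1985Variational, (26) p.282] -/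
theorem hessFormAt_self (η : ℝ) (U₀ : GaugeField P j (SU N)) (X : TangentBondSU P j N) :
    hessFormAt η U₀ X X = (hessPair (torusT P j) (dirForm (cfgGL N U₀)) η 4 ((N : ℂ)⁻¹ • Matrix.traceLinearMap (Fin N) ℂ ℂ) (hermLetter η U₀ X)).re := by
  unfold hessFormAt
  rw [B9Eq310Hermitian.bondPair_deltaOp_self (torusT P j) (dirForm (cfgGL N U₀)) _ (fun a b => by simp [Matrix.trace_mul_comm a b])]

/-- The Hessian form as an `ℝ`-bilinear map (the shape `opOfSesq` consumes; over `ℝ` the conjugate-linear slot is linear). [cite: Balaban1985BackgroundPropagators, (3.10) p.392 (bookkeeping)] -/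
def hessSesqAt (η : ℝ) (U₀ : GaugeField P j (SU N)) : TangentBondSU P j N →ₗ⋆[ℝ] TangentBondSU P j N →ₗ[ℝ] ℝ :=
  LinearMap.mk₂'ₛₗ (starRingEnd ℝ) (RingHom.id ℝ) (hessFormAt η U₀) (hessFormAt_add_left η U₀)
    (fun c X Y => by rw [hessFormAt_smul_left, starRingEnd_apply, star_trivial, smul_eq_mul])
    (hessFormAt_add_right η U₀) (fun c X Y => by rw [hessFormAt_smul_right, RingHom.id_apply, smul_eq_mul])

/-- Unfolding. [cite: Balaban1985BackgroundPropagators, (3.10) p.392 (bookkeeping)] -/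
@[simp] theorem hessSesqAt_apply (η : ℝ) (U₀ : GaugeField P j (SU N)) (X Y : TangentBondSU P j N) : hessSesqAt η U₀ X Y = hessFormAt η U₀ X Y := rfl

/-! ## §3 ★ The Hessian OPERATOR `Δ^η(U₀)` on the tangent carrier — «a hermitian operator given by the quadratic form» -/

/-- ★ **THE HESSIAN OPERATOR OF THE ACTION OF RECORD AT `U₀`**: the `ℝ`-linear operator on `𝔰𝔲(N)`-valued bond fields REPRESENTING `𝔥_{U₀}` (Riesz on the finite
lattice, `B9Eq310HessianOperator.opOfSesq`): `⟪X, Δ_{U₀} Y⟫ = Re ⟨A_X, Δ^η(U₀) A_Y⟩` — [5] (3.10)'s «hermitian operator given by the quadratic form», compressed to the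
`SU(N)` tangent space (the traceless part is what the inner product sees). [cite: Balaban1985BackgroundPropagators, (3.10) p.392; Balaban1985Variational, (26) p.282] -/
def hessOpAt (η : ℝ) (U₀ : GaugeField P j (SU N)) : TangentBondSU P j N →ₗ[ℝ] TangentBondSU P j N :=
  B9Eq310HessianOperator.opOfSesq (hessSesqAt η U₀)

/-- ★ `⟪X, Δ_{U₀} Y⟫ = 𝔥_{U₀}(X, Y)`. [cite: Balaban1985BackgroundPropagators, (3.10) p.392] -/
theorem inner_hessOpAt (η : ℝ) (U₀ : GaugeField P j (SU N)) (X Y : TangentBondSU P j N) : ⟪X, hessOpAt η U₀ Y⟫_ℝ = hessFormAt η U₀ X Y :=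
  B9Eq310HessianOperator.inner_opOfSesq (hessSesqAt η U₀) X Y

/-- ★ **`Δ_{U₀}` IS SYMMETRIC** («it is a hermitian operator»). [cite: Balaban1985BackgroundPropagators, (3.10) p.392] -/
theorem hessOpAt_isSymmetric (η : ℝ) (U₀ : GaugeField P j (SU N)) : (hessOpAt η U₀ : TangentBondSU P j N →ₗ[ℝ] TangentBondSU P j N).IsSymmetric := by
  intro X Y
  rw [inner_hessOpAt, ← real_inner_comm, inner_hessOpAt, hessFormAt_symm]

/-- ★ **THE QUADRATIC FORM OF `Δ_{U₀}` IS PRINT'S**: `⟪X, Δ_{U₀} X⟫ = Re ⟨A_X, Δ^η(U₀)A_X⟩` = the second-order coefficient of [15] (26) at `A = A_X`.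
[cite: Balaban1985Variational, (26) p.282; Balaban1985BackgroundPropagators, (3.10) p.392] -/
theorem inner_hessOpAt_self (η : ℝ) (U₀ : GaugeField P j (SU N)) (X : TangentBondSU P j N) :
    ⟪X, hessOpAt η U₀ X⟫_ℝ = (hessPair (torusT P j) (dirForm (cfgGL N U₀)) η 4 ((N : ℂ)⁻¹ • Matrix.traceLinearMap (Fin N) ℂ ℂ) (hermLetter η U₀ X)).re := by
  rw [inner_hessOpAt, hessFormAt_self]

end Form

/-! ## §4 The dictionary between pv27's pairing (3.11) at print's letters and the tangent carrier's inner product -/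

section Dictionary

/-- The inner product of the tangent carrier, bond by bond: `⟪X, Y⟫ = Σ_b Re tr(X_b* Y_b)` (`PiLp.inner_apply`, `T4AdjointCovarianceUnitary`'s Hilbert–Schmidt form on `lieSU`).
[cite: Balaban1985Averaging, (17) p.21; Balaban1985BackgroundPropagators, p.391] -/
theorem inner_tangentBondSU (X Y : TangentBondSU P j N) :
    ⟪X, Y⟫_ℝ = ∑ b : PBond P j, (Matrix.conjTranspose ((X b : lieSU (Fin N)) : Matrix (Fin N) (Fin N) ℂ) * ((Y b : lieSU (Fin N)) : Matrix (Fin N) (Fin N) ℂ)).trace.re := by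
  rw [PiLp.inner_apply]
  refine Finset.sum_congr rfl fun b _ => ?_
  rfl

/-- ★ **`Re ⟨A_X, A_Y⟩_{(3.11)} = (η²∕N)·⟪X, Y⟫`**: pv27's bond pairing of print's hermitian letters IS the tangent carrier's inner product up to the factor `η^{d−2}∕N`
(`d = 4`; `A_X = (iη)⁻¹U₀XU₀*`, `tr(U₀XU₀*·U₀YU₀*) = tr(XY) = −tr(X*Y)` for skew `X`). [cite: Balaban1985BackgroundPropagators, (3.11) p.392; Balaban1985Averaging, (17) p.21] -/
theorem re_bondPair_hermLetter {η : ℝ} (hη : η ≠ 0) (U₀ : GaugeField P j (SU N)) (X Y : TangentBondSU P j N) :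
    (bondPair η 4 ((N : ℂ)⁻¹ • Matrix.traceLinearMap (Fin N) ℂ ℂ) (hermLetter η U₀ X) (hermLetter η U₀ Y)).re = η ^ 2 / N * ⟪X, Y⟫_ℝ := by
  -- each summand of the pairing: `τ_N(A_X A_Y) = −(η²)⁻¹ N⁻¹ tr(X Y)`
  have hterm : ∀ (μ : Fin P.d) (x : Site P j),
      ((N : ℂ)⁻¹ • Matrix.traceLinearMap (Fin N) ℂ ℂ) (hermLetter η U₀ X μ x * hermLetter η U₀ Y μ x) =
        -((((η : ℂ) ^ 2)⁻¹ * (N : ℂ)⁻¹) *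
          (((X ⟨x, μ⟩ : lieSU (Fin N)) : Matrix (Fin N) (Fin N) ℂ) * ((Y ⟨x, μ⟩ : lieSU (Fin N)) : Matrix (Fin N) (Fin N) ℂ)).trace) := by
    intro μ x
    set U : Matrix (Fin N) (Fin N) ℂ := ((U₀ ⟨x, μ⟩ : SU N) : Matrix (Fin N) (Fin N) ℂ) with hUdef
    set A : Matrix (Fin N) (Fin N) ℂ := ((X ⟨x, μ⟩ : lieSU (Fin N)) : Matrix (Fin N) (Fin N) ℂ)
    set B : Matrix (Fin N) (Fin N) ℂ := ((Y ⟨x, μ⟩ : lieSU (Fin N)) : Matrix (Fin N) (Fin N) ℂ)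
    have hU : star U * U = 1 := Unitary.star_mul_self_of_mem (U₀ ⟨x, μ⟩).2.1
    have hprod : U * A * star U * (U * B * star U) = U * (A * B) * star U := by
      calc U * A * star U * (U * B * star U) = U * A * (star U * U) * B * star U := by simp only [Matrix.mul_assoc]
        _ = U * (A * B) * star U := by rw [hU, Matrix.mul_one, Matrix.mul_assoc U A B]
    have hc : ((Complex.I * η : ℂ))⁻¹ * ((Complex.I * η : ℂ))⁻¹ = -(((η : ℂ) ^ 2)⁻¹) := by
      have h2 : (Complex.I * η : ℂ) * (Complex.I * η : ℂ) = -((η : ℂ) ^ 2) := by linear_combination (η : ℂ) ^ 2 * Complex.I_sq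
      rw [← mul_inv, h2, inv_neg]
    simp only [hermLetter]
    rw [smul_mul_smul_comm, hprod, map_smul, LinearMap.smul_apply, Matrix.traceLinearMap_apply, Matrix.trace_mul_cycle U (A * B) (star U), hU,
      Matrix.one_mul, hc, smul_eq_mul, smul_eq_mul]
    ring
  -- the carrier side: `⟪X, Y⟫ = Σ_x Σ_μ −Re tr(X_b Y_b)` (`X_b* = −X_b`), the bond sum read as a site–direction sum
  have hsum : ∀ g : PBond P j → ℝ, ∑ b, g b = ∑ x : Site P j, ∑ μ : Fin P.d, g ⟨x, μ⟩ := fun g => by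
    rw [← Finset.sum_product']
    exact (Fintype.sum_equiv ⟨fun p : Site P j × Fin P.d => (⟨p.1, p.2⟩ : PBond P j), fun b => (b.src, b.dir), fun _ => rfl, fun _ => rfl⟩
      _ _ (fun _ => rfl)).symm
  have hinner : ⟪X, Y⟫_ℝ = ∑ x : Site P j, ∑ μ : Fin P.d,
      -((((X ⟨x, μ⟩ : lieSU (Fin N)) : Matrix (Fin N) (Fin N) ℂ) * ((Y ⟨x, μ⟩ : lieSU (Fin N)) : Matrix (Fin N) (Fin N) ℂ)).trace).re := by
    rw [inner_tangentBondSU, hsum]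
    refine Finset.sum_congr rfl fun x _ => Finset.sum_congr rfl fun μ _ => ?_
    have hX : star (((X ⟨x, μ⟩ : lieSU (Fin N)) : Matrix (Fin N) (Fin N) ℂ)) = -((X ⟨x, μ⟩ : lieSU (Fin N)) : Matrix (Fin N) (Fin N) ℂ) :=
      (T4AdjointCovarianceUnitary.mem_lieSU_iff.mp (X ⟨x, μ⟩).2).1
    rw [← Matrix.star_eq_conjTranspose, hX, neg_mul, Matrix.trace_neg, Complex.neg_re]
  set S : ℂ := ∑ x : Site P j, ∑ μ : Fin P.d,
      (((X ⟨x, μ⟩ : lieSU (Fin N)) : Matrix (Fin N) (Fin N) ℂ) * ((Y ⟨x, μ⟩ : lieSU (Fin N)) : Matrix (Fin N) (Fin N) ℂ)).trace with hSdef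
  rw [hinner, bondPair]
  simp only [hterm, Finset.sum_neg_distrib, ← Finset.mul_sum]
  rw [← hSdef]
  have hS : (η : ℂ) ^ 4 * -(((η : ℂ) ^ 2)⁻¹ * (N : ℂ)⁻¹ * S) = (((-(η ^ 2 / N)) : ℝ) : ℂ) * S := by
    have hη' : (η : ℂ) ≠ 0 := Complex.ofReal_ne_zero.mpr hη
    push_cast
    field_simp
  rw [hS, Complex.re_ofReal_mul, hSdef, Complex.re_sum]
  simp only [Complex.re_sum, Finset.mul_sum, Finset.sum_neg_distrib, neg_mul, mul_neg]

end Dictionary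

/-! ## §5 The flat background: at `U₀ = 1` the Hessian form is `N⁻¹ Σ_p ‖(dX)(p)‖²_{HS} ≥ 0` («generalizing the operator ∂*∂ in the Abelian case», [5] p. 392) -/

section Flat
open scoped Matrix.Norms.L2Operator

variable [NeZero N]

/-- The datum of record of the trivial `SU(N)` configuration is pv27's trivial background. [cite: Balaban1985BackgroundPropagators, p.392 (bookkeeping)] -/
theorem dirForm_cfgGL_one : dirForm (cfgGL N (1 : GaugeField P j (SU N))) = fun _ _ => (1 : (Matrix (Fin N) (Fin N) ℂ)ˣ) := by
  funext μ x
  ext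
  rfl

/-- At `U₀ = 1` print's letter is `A_X = (iη)⁻¹·X`. [cite: Balaban1985Variational, (22) p.281 (bookkeeping)] -/
theorem hermLetter_one (η : ℝ) (X : TangentBondSU P j N) :
    hermLetter η (1 : GaugeField P j (SU N)) X = fun μ x => ((Complex.I * η : ℂ))⁻¹ • (((X ⟨x, μ⟩ : lieSU (Fin N)) : Matrix (Fin N) (Fin N) ℂ)) := by
  funext μ x
  simp only [hermLetter]
  congr 1
  change (1 : Matrix (Fin N) (Fin N) ℂ) * _ * star (1 : Matrix (Fin N) (Fin N) ℂ) = _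
  rw [one_mul, star_one, mul_one]

omit [NeZero N] in
/-- pv27's `Δ′` form VANISHES at the trivial background (`Re U(∂p) − 1 = 0`, `Im U(∂p) = 0`). [cite: Balaban1985BackgroundPropagators, (3.10) p.392 («Δ′ … small perturbation of D*D»; zero at U = 1)] -/
theorem deltaPrime_one {S ι 𝔸 : Type*} [Fintype S] [Fintype ι] [LinearOrder ι] [NormedRing 𝔸] [NormedAlgebra ℂ 𝔸] [CompleteSpace 𝔸]
    (T : ι → Equiv.Perm S) (η : ℝ) (d : ℕ) (τ : 𝔸 →ₗ[ℂ] ℂ) (A : ι → S → 𝔸) :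
    B9Eq39Adjoint.deltaPrime T (fun _ _ => (1 : 𝔸ˣ)) η d τ A = 0 := by
  unfold B9Eq39Adjoint.deltaPrime
  have h1 : ∀ μ ν x, B9Eq39Adjoint.plaqU T (fun _ _ => (1 : 𝔸ˣ)) μ ν x = 1 := fun μ ν x => by
    simp only [B9Eq39Adjoint.plaqU, mul_one, inv_one]
  simp only [h1, B9Eq37Insertion.reC_one, B9Eq37Insertion.imC_one, sub_self, smul_zero, mul_zero, map_zero, zero_add,
    Finset.sum_const_zero]

/-- ★ **AT THE TRIVIAL BACKGROUND THE HESSIAN FORM OF RECORD IS THE FLAT LAPLACIAN FORM**: `𝔥_1(X, X) = N⁻¹ · Σ_{p} Re tr((dX)(p)*(dX)(p))` with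
`dX := curl (torusT P j) 1 X` pv27's exterior derivative of the bond field at `U = 1` ((3.4) with `R(1) = id`: `(dX)(p_{μν}(x)) = X_ν(x+e_μ) − X_ν(x) − X_μ(x+e_ν) + X_μ(x)`)
— «the operator ∂*∂ in the Abelian case» ([5] p. 392): `Δ′ = 0` at `U = 1` (`deltaPrime_one`), `⟨A, D*DA⟩ = Σ_p τ((DA)(p)²)` (pv27 `bondPair_divPη_curlη`), and
`A_X = (iη)⁻¹X` skew-valued.  In particular `η` drops out. [cite: Balaban1985BackgroundPropagators, (3.10) p.392, (3.4) p.391] -/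
theorem hessFormAt_one_self {η : ℝ} (hη : η ≠ 0) (X : TangentBondSU P j N) :
    hessFormAt η (1 : GaugeField P j (SU N)) X X =
      (N : ℝ)⁻¹ * ∑ q ∈ B9Eq39Adjoint.posPlaq (Site P j) (Fin P.d),
        (Matrix.conjTranspose
            (B9Eq39Adjoint.curl (torusT P j) (fun _ _ => (1 : (Matrix (Fin N) (Fin N) ℂ)ˣ))
              (fun μ x => ((X ⟨x, μ⟩ : lieSU (Fin N)) : Matrix (Fin N) (Fin N) ℂ)) q.2.1 q.2.2 q.1) *
          B9Eq39Adjoint.curl (torusT P j) (fun _ _ => (1 : (Matrix (Fin N) (Fin N) ℂ)ˣ))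
            (fun μ x => ((X ⟨x, μ⟩ : lieSU (Fin N)) : Matrix (Fin N) (Fin N) ℂ)) q.2.1 q.2.2 q.1).trace.re := by
  set T := torusT P j with hT
  set X' : Fin P.d → Site P j → Matrix (Fin N) (Fin N) ℂ := fun μ x => ((X ⟨x, μ⟩ : lieSU (Fin N)) : Matrix (Fin N) (Fin N) ℂ) with hX'
  have hτ : ∀ a b : Matrix (Fin N) (Fin N) ℂ, ((N : ℂ)⁻¹ • Matrix.traceLinearMap (Fin N) ℂ ℂ) (a * b) =
      ((N : ℂ)⁻¹ • Matrix.traceLinearMap (Fin N) ℂ ℂ) (b * a) := fun a b => by simp [Matrix.trace_mul_comm a b]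
  have hA : hermLetter η (1 : GaugeField P j (SU N)) X = ((Complex.I * η : ℂ))⁻¹ • X' := by
    rw [hermLetter_one]
    rfl
  have hsplit : deltaOp T (fun _ _ => (1 : (Matrix (Fin N) (Fin N) ℂ)ˣ)) η (((Complex.I * η : ℂ))⁻¹ • X') =
      B9Eq39Adjoint.divPη T (fun _ _ => 1) η (B9Eq39Adjoint.curlη T (fun _ _ => 1) η (((Complex.I * η : ℂ))⁻¹ • X')) +
        B9Eq310Hermitian.deltaPrimeOp T (fun _ _ => 1) η (((Complex.I * η : ℂ))⁻¹ • X') := by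
    funext μ x
    rfl
  -- the curl of print's letter is a scalar multiple of the flat curl of `X`, which is skew
  have hcurl : ∀ μ ν x, B9Eq39Adjoint.curlη T (fun _ _ => (1 : (Matrix (Fin N) (Fin N) ℂ)ˣ)) η (((Complex.I * η : ℂ))⁻¹ • X') μ ν x =
      (((η : ℂ))⁻¹ * ((Complex.I * η : ℂ))⁻¹) • B9Eq39Adjoint.curl T (fun _ _ => 1) X' μ ν x := fun μ ν x => by
    rw [B9Eq39Adjoint.curlη, B9Eq39Adjoint.curl_smul, smul_smul]
  have hskew : ∀ μ ν x, star (B9Eq39Adjoint.curl T (fun _ _ => (1 : (Matrix (Fin N) (Fin N) ℂ)ˣ)) X' μ ν x) =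
      -B9Eq39Adjoint.curl T (fun _ _ => 1) X' μ ν x := fun μ ν x => by
    have hU : ∀ (μ : Fin P.d) (x : Site P j), ((((fun _ _ => (1 : (Matrix (Fin N) (Fin N) ℂ)ˣ)) μ x)⁻¹ : (Matrix (Fin N) (Fin N) ℂ)ˣ) :
        Matrix (Fin N) (Fin N) ℂ) = star (((fun _ _ => (1 : (Matrix (Fin N) (Fin N) ℂ)ˣ)) μ x : (Matrix (Fin N) (Fin N) ℂ)ˣ) : Matrix (Fin N) (Fin N) ℂ) :=
      fun _ _ => by simp
    have hX : star X' = (-1 : ℂ) • X' := by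
      funext κ y
      simp only [Pi.star_apply, Pi.smul_apply, neg_smul, one_smul, hX']
      exact (T4AdjointCovarianceUnitary.mem_lieSU_iff.mp (X ⟨y, κ⟩).2).1
    rw [B9Eq310Hermitian.star_curl T _ hU, hX, B9Eq39Adjoint.curl_smul, neg_smul, one_smul]
  unfold hessFormAt
  rw [dirForm_cfgGL_one, hA, ← hT, hsplit, B9Eq310Hermitian.bondPair_add_right,
    B9Eq310Hermitian.bondPair_deltaPrimeOp_self T (fun _ _ => (1 : (Matrix (Fin N) (Fin N) ℂ)ˣ)) ((N : ℂ)⁻¹ • Matrix.traceLinearMap (Fin N) ℂ ℂ) hτ η 4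
      (((Complex.I * η : ℂ))⁻¹ • X'),
    deltaPrime_one, add_zero,
    B9Eq39Adjoint.bondPair_divPη_curlη T (fun _ _ => (1 : (Matrix (Fin N) (Fin N) ℂ)ˣ)) ((N : ℂ)⁻¹ • Matrix.traceLinearMap (Fin N) ℂ ℂ) hτ η 4
      (((Complex.I * η : ℂ))⁻¹ • X')]
  simp only [hcurl, smul_mul_smul_comm, map_smul, LinearMap.smul_apply, Matrix.traceLinearMap_apply, smul_eq_mul, ← Finset.mul_sum]
  have hη' : (η : ℂ) ≠ 0 := Complex.ofReal_ne_zero.mpr hη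
  have hI2 : (Complex.I * η : ℂ)⁻¹ * (Complex.I * η : ℂ)⁻¹ = -(((η : ℂ) ^ 2)⁻¹) := by
    have h2 : (Complex.I * η : ℂ) * (Complex.I * η : ℂ) = -((η : ℂ) ^ 2) := by linear_combination (η : ℂ) ^ 2 * Complex.I_sq
    rw [← mul_inv, h2, inv_neg]
  have hcoef : (η : ℂ) ^ 4 * (((η : ℂ))⁻¹ * (Complex.I * η : ℂ)⁻¹ * (((η : ℂ))⁻¹ * (Complex.I * η : ℂ)⁻¹)) = -1 := by
    have h3 : ((η : ℂ))⁻¹ * (Complex.I * η : ℂ)⁻¹ * (((η : ℂ))⁻¹ * (Complex.I * η : ℂ)⁻¹) =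
        (((η : ℂ))⁻¹ * ((η : ℂ))⁻¹) * ((Complex.I * η : ℂ)⁻¹ * (Complex.I * η : ℂ)⁻¹) := by ring
    rw [h3, hI2]
    field_simp
  rw [← mul_assoc, hcoef, neg_one_mul, Complex.neg_re, show ((N : ℂ))⁻¹ = (((N : ℝ)⁻¹ : ℝ) : ℂ) by push_cast; rfl, Complex.re_ofReal_mul,
    Complex.re_sum, ← mul_neg, ← Finset.sum_neg_distrib]
  congr 1
  refine Finset.sum_congr rfl fun q _ => ?_
  rw [← Matrix.star_eq_conjTranspose, hskew, neg_mul, Matrix.trace_neg, Complex.neg_re]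

/-- ★ **`Δ_1 ≥ 0`**: at the trivial background the Hessian form of record is non-negative (a sum of Hilbert–Schmidt squares `Re tr((dX)(p)*(dX)(p)) = Σ|·|²`).
[cite: Balaban1985BackgroundPropagators, (3.10) p.392 («generalizing the operator ∂*∂ in the Abelian case»)] -/
theorem hessFormAt_one_self_nonneg {η : ℝ} (hη : η ≠ 0) (X : TangentBondSU P j N) : 0 ≤ hessFormAt η (1 : GaugeField P j (SU N)) X X := by
  rw [hessFormAt_one_self hη]
  refine mul_nonneg (inv_nonneg.mpr (Nat.cast_nonneg N)) (Finset.sum_nonneg fun q _ => ?_)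
  rw [MatrixNorms.trace_conjTranspose_mul_self, Complex.ofReal_re]
  exact Finset.sum_nonneg fun _ _ => Finset.sum_nonneg fun _ _ => sq_nonneg _

/-- ★ … equivalently `0 ≤ ⟪X, Δ_1 X⟫` for the Hessian OPERATOR at the trivial background. [cite: Balaban1985BackgroundPropagators, (3.10) p.392] -/
theorem inner_hessOpAt_one_self_nonneg {η : ℝ} (hη : η ≠ 0) (X : TangentBondSU P j N) : 0 ≤ ⟪X, hessOpAt η (1 : GaugeField P j (SU N)) X⟫_ℝ := by
  rw [inner_hessOpAt]
  exact hessFormAt_one_self_nonneg hη X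

end Flat

end Literature.MathematicalPhysics.QuantumFieldTheory.Balaban1983to89.Node00

end
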